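import Mathlib
import HarnessLib
import Summits.Parity.GeneralizedHardyLittlewood.Theorems.LeeYangFibresFibreHyperbolicityAlongDefs
import Summits.Parity.GeneralizedHardyLittlewood.Theorems.ModelHyperbolicity.Negative.ModelHyperbolicityNotMonotone

/-!
# Crux `FibreHyperbolicityAlong` (stmt-Parity-18103), line `sifted-chowla-distillation`:
# the robust row `stub_robustRowExp` — elementary half (lobe certificate ⇒ robustness)

`RobustRowExp` (vocabulary file `LeeYangFibresFibreHyperbolicityAlongDefs`) asks for an exponential
robustness radius `e^{-Cu}` for real-rootedness of the Buchstab–Dickman row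
`F_u(z) = Σ_{j<u} I_{j+1}(u) z^j` (`I_{j+1}(u) = cellDensity j u`) against coefficientwise relative
perturbations measured by `rowTol`.  Its proof splits as

* `ModelLobeMargin` (ANALYTIC, open; stated in the vocabulary file, registered stub `stub_modelLobeMargin`): a SIGN CERTIFICATE with
  exponential margin — for some `C` and all large `u` there are `u - 1` strictly decreasing real test
  points `x_0 > x_1 > ⋯ > x_{u-2}` at which `(-1)^k F_u(x_k)` exceeds `e^{-Cu}` times the tolerance
  polynomial `Σ_{j<u} I_{j+1}(u)|x_k|^j + I_{u-1}(u)|x_k|^{u-1}` (one point per lobe of `F_u` on the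
  negative axis, `x_0 = 0`, `x_{u-2}` beyond the top zero; numerically the shallowest lobe has relative
  depth `θ*(u) ≈ 7.5·e^{-0.94u}`, the top zero is `≈ e^{0.8u}`, so every `C > 2` is expected to work);
* `stub_robustRowOfLobeMargin : ModelLobeMargin → RobustRowExp` (registered stub; ELEMENTARY, proved here):
  a row `b` within `e^{-Cu}·rowTol` of the densities differs from `F_u` at `x_k` by at most
  `e^{-Cu}·(tolerance polynomial at |x_k|) < |F_u(x_k)|`, so `Σ b_j X^j` alternates strictly in sign
  along the `u - 1` points, hence has `≥ u - 2` real roots (`le_card_roots_of_alternating`, IVT); its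
  degree is `≤ u - 1 ≤ (u - 2) + 1`, and a real polynomial whose degree exceeds its real-root count by at
  most one splits over `ℝ` (the top coefficient `b_{u-1}`, `|b_{u-1}| ≤ e^{-Cu} I_{u-1}(u)`, can only add
  ONE more zero, necessarily real), so every complex zero is real
  (`im_eq_zero_of_natDegree_le_card_roots`).

Pattern: `ModelTransfer.stub_perturb` (`LeeYangFibresFibreHyperbolicityPerturb.lean`, p86826), whose
ineffective `ε(Q) > 0` is replaced by the explicit certificate.

Refinement (tree: `LeeYangFibresFibreHyperbolicityAlongMarginGeometry{,Aux}.lean`, p162733/p162517): `ModelLobeMargin` itself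
follows (`stub_lobeMarginOfZeroGeometry`, `C = 6 + 3B`) from the pure ZERO GEOMETRY `ModelZeroGeometry` of the row
(first zero `≤ B`, unit non-decreasing gaps, top zero `≤ e^{B(u-2)}`, full factorisation — Conjecture G of
card `dickman-dictionary-unit-gaps`, corrected) by the elementary `MarginGeometry.margin_from_geometry`.
-/

noncomputable section

namespace Summit.Parity.GeneralizedHardyLittlewood.Cruxes.FibreHyperbolicityAlong.SiftedChowlaDistillation

open scoped BigOperators Classical
open Polynomial
open Summit.Parity.GeneralizedHardyLittlewood.Cruxes.ModelHyperbolicity.WindowChainTransport (cellDensity)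
open Summit.Parity.GeneralizedHardyLittlewood.Theorems.ModelHyperbolicity.Negative
  (im_eq_zero_of_natDegree_le_card_roots le_card_roots_of_alternating)

/-! ## Elementary lemmas (the statement `ModelLobeMargin` and the object `rowPoly` with its API are the tree's:
`Theorems/LeeYangFibresFibreHyperbolicityAlongDefs`, appended section `RowResidue`, p161783) -/

/-- The tolerance polynomial of `RobustRowExp`: `Σ_{j<u} rowTol (j+1) u · y^j = Σ_{j<u} I_{j+1}(u) y^j +
I_{u-1}(u) y^{u-1}` (the top index carries the extra `I_{u-1}(u)`). -/
theorem sum_rowTol_mul_pow {u : ℕ} (hu : 1 ≤ u) (y : ℝ) :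
    ∑ j ∈ Finset.range u, rowTol (j + 1) u * y ^ j =
      (∑ j ∈ Finset.range u, cellDensity j u * y ^ j) + cellDensity (u - 2) u * y ^ (u - 1) := by
  have h : ∀ j ∈ Finset.range u, rowTol (j + 1) u * y ^ j =
      cellDensity j u * y ^ j + (if j = u - 1 then cellDensity (u - 2) u * y ^ j else 0) := by
    intro j _
    unfold rowTol
    rw [Nat.add_sub_cancel]
    by_cases hj' : j = u - 1
    · rw [if_pos (show j + 1 = u by omega), if_pos hj']
      ring
    · rw [if_neg (show j + 1 ≠ u by omega), if_neg hj']
      ring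
  rw [Finset.sum_congr rfl h, Finset.sum_add_distrib, Finset.sum_ite_eq']
  rw [if_pos (Finset.mem_range.mpr (by omega))]

/-- A real polynomial whose degree exceeds its number of real roots (with multiplicity) by at most one has
exactly as many real roots as its degree: the rootless cofactor of `∏ (X - r)` has degree `≤ 1`, and a
real polynomial of degree `1` has a root. -/
-- adapted from `ModelTransfer.natDegree_le_card_roots_of_le_succ` (private, LeeYangFibresFibreHyperbolicityPerturb.lean)
theorem natDegree_le_card_roots_of_le_succ {p : ℝ[X]}
    (h : p.natDegree ≤ p.roots.card + 1) : p.natDegree ≤ p.roots.card := by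
  obtain ⟨q, -, hdeg, hroots⟩ := p.exists_prod_multiset_X_sub_C_mul
  have hq1 : q.natDegree ≤ 1 := by omega
  by_contra hlt
  have hq : q.natDegree = 1 := by omega
  obtain ⟨a, b, rfl⟩ : ∃ a b : ℝ, q = C a * X + C b := ⟨_, _, eq_X_add_C_of_natDegree_le_one hq1⟩
  have ha : a ≠ 0 := by
    rintro rfl
    simp at hq
  have hq0 : C a * X + C b ≠ 0 := by
    intro h0
    rw [h0, natDegree_zero] at hq
    omega
  have hroot : -b / a ∈ (C a * X + C b).roots := by
    rw [mem_roots hq0, IsRoot.def]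
    simp only [eval_add, eval_mul, eval_C, eval_X]
    field_simp
    ring
  rw [hroots] at hroot
  exact Multiset.notMem_zero _ hroot

/-- Sign transfer: if `|b_j - I_{j+1}(u)| ≤ θ · rowTol (j+1) u` for `j < u` and the certificate
`θ · Σ rowTol (j+1) u |y|^j < s · F_u(y)` holds with a sign `s = ±1`, then `s · Σ b_j y^j > 0`. -/
theorem sign_of_certificate {u : ℕ} {b : ℕ → ℝ} {θ s y : ℝ} (hs : s = 1 ∨ s = -1)
    (hb : ∀ j : ℕ, j < u → |b j - cellDensity j u| ≤ θ * rowTol (j + 1) u)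
    (hcert : θ * ∑ j ∈ Finset.range u, rowTol (j + 1) u * |y| ^ j <
      s * ∑ j ∈ Finset.range u, cellDensity j u * y ^ j) :
    0 < s * ∑ j ∈ Finset.range u, b j * y ^ j := by
  set Q := ∑ j ∈ Finset.range u, b j * y ^ j with hQ
  set F := ∑ j ∈ Finset.range u, cellDensity j u * y ^ j with hF
  have hdiff : |Q - F| ≤ θ * ∑ j ∈ Finset.range u, rowTol (j + 1) u * |y| ^ j := by
    have hQF : Q - F = ∑ j ∈ Finset.range u, (b j - cellDensity j u) * y ^ j := by
      rw [hQ, hF, ← Finset.sum_sub_distrib]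
      refine Finset.sum_congr rfl fun j _ => ?_
      ring
    rw [hQF, Finset.mul_sum]
    refine (Finset.abs_sum_le_sum_abs _ _).trans (Finset.sum_le_sum fun j hj => ?_)
    rw [abs_mul, abs_pow, ← mul_assoc]
    exact mul_le_mul_of_nonneg_right (hb j (Finset.mem_range.mp hj)) (pow_nonneg (abs_nonneg _) _)
  have habs : |s * (Q - F)| = |Q - F| := by
    rw [abs_mul]
    rcases hs with rfl | rfl <;> simp
  have hle : -|Q - F| ≤ s * (Q - F) := by
    rw [← habs]
    exact neg_abs_le _
  have hid : s * Q = s * F + s * (Q - F) := by ring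
  linarith

/-! ## The elementary half of `stub_robustRowExp` -/

/-- **Lobe certificate ⇒ robust row.**  `ModelLobeMargin → RobustRowExp`, with the same constant `C`
(and threshold `max u₀ 2`). -/
theorem stub_robustRowOfLobeMargin : ModelLobeMargin → RobustRowExp := by
  intro h
  obtain ⟨C, hC, u₀, hu₀⟩ := h
  refine ⟨C, hC, max u₀ 2, fun u hu b hb z hz => ?_⟩
  have hu₀u : u₀ ≤ u := le_of_max_le_left hu
  have h2u : 2 ≤ u := le_of_max_le_right hu
  obtain ⟨x, hxmono, hmargin⟩ := hu₀ u hu₀u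
  set q : ℝ[X] := rowPoly u b with hq
  -- the perturbed row has the sign `(-1)^k` at `x k`, `k ≤ u - 2`
  have hsign : ∀ k : ℕ, k + 1 < u → 0 < (-1) ^ k * q.eval (x k) := by
    intro k hk
    rw [hq, rowPoly_eval]
    refine sign_of_certificate (neg_one_pow_eq_or ℝ k) hb ?_
    rw [sum_rowTol_mul_pow (by omega)]
    exact hmargin k hk
  have hq0 : q ≠ 0 := by
    intro h0
    have := hsign 0 (by omega)
    simp [h0] at this
  -- hence it alternates strictly along the increasing points `x (u-2), x (u-3), …, x 0`
  have hdle : u - 2 ≤ q.roots.card := by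
    refine le_card_roots_of_alternating q (fun i => x (u - 2 - i)) (fun i hi => ?_) (fun i hi => ?_) hq0
    · have := hxmono (u - 2 - (i + 1)) (by omega)
      rwa [show u - 2 - (i + 1) + 1 = u - 2 - i by omega] at this
    · have h1 := hsign (u - 2 - (i + 1)) (by omega)
      have h2 := hsign (u - 2 - i) (by omega)
      rw [show u - 2 - i = u - 2 - (i + 1) + 1 by omega] at h2 ⊢
      rw [pow_succ] at h2
      rcases neg_one_pow_eq_or ℝ (u - 2 - (i + 1)) with hs | hs
      · rw [hs] at h1 h2
        nlinarith
      · rw [hs] at h1 h2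
        nlinarith
  -- degree `≤ u - 1 ≤ (u - 2) + 1`, so all roots are real
  have hdeg : q.natDegree ≤ q.roots.card := by
    refine natDegree_le_card_roots_of_le_succ ?_
    have := rowPoly_natDegree_lt (show 1 ≤ u by omega) b
    rw [← hq] at this
    omega
  have hz' : (q.map (algebraMap ℝ ℂ)).eval z = 0 := by
    rw [hq, rowPoly_map_eval]
    exact hz
  exact im_eq_zero_of_natDegree_le_card_roots hq0 hdeg hz'

end Summit.Parity.GeneralizedHardyLittlewood.Cruxes.FibreHyperbolicityAlong.SiftedChowlaDistillation

end
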